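import Summits.NavierStokesRegularity.NavierStokesRegularity.Theorems.ScaledTopAlignmentTypeIProfileUniformDecoherence
import HarnessLib

/-!
# Route `ScaledTopAlignment`, crux W3ᵐᵗ = `AprioriMostTimesBulkAlignment` (stmt-NavierStokesRegularity-19551):
# Type-I blow-up PROFILES are uniformly window-decoherent IN THE BULK — the quantitative kill-shape of the
# measure-form doors W3′ / W3ʷᵇ / W3ᵐᵗ

Companion of `ScaledTopAlignmentTypeIProfileUniformDecoherence` (sup form: every rate-floor window of every
Type-I profile contains a point of the relative top set misaligned by more than `ε(C)`). The doors of record of the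
route are MEASURE-form («the `ε`-misaligned part of the relative top set inside the window has volume `≤ δℓ³`»), so
their kill-shape is the BULK statement proved here:

* **`typeIAncientMild_uniform_window_bulk_decoherence`** — for every `C`, `κ > 0`, `λ₀ < 1`, `R₀ > 0`, `s < 0` there
  are `ε > 0` AND `δ > 0` such that for every profile `W ∈ IsTypeIAncientMild C`, every `y₀` with
  `κ ≤ |curl W(s)(y₀)|` and every anchor `e ≠ 0`, the set of points `y` of the `λ₀`-relative top set inside the
  window `|y₀ − y| ≤ R₀ℓ`, `ℓ = √(1/|curl W(s)(y₀)|)`, with `sin∠(e, ξ(y)) > ε` has volume `> δℓ³`;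
* `typeIAncientMild_uniform_window_bulk_decoherence_anchored` — the same with `e = curl W(s)(y₀)` (verbatim the
  negation, uniform over the class, of the window clause of W3ʷᵇ/W3ᵐᵗ at a profile).

Proof (no Fatou lemma needed): if windows of profiles `W_n` around `y₀ⁿ` had `1/(n+1)`-misaligned parts of volume
`≤ ℓ_n³/(n+1)`, translate the centres to the origin, extract a `C¹_loc`-convergent subsequence of the profiles
(`exists_tendsto_of_isTypeIAncientMild_seq`) and of the unit anchors; the limit has `|curl W_∞(s)(0)| ≥ κ`, hence a
ball `B(0,r)` inside every late window. Every point of `B(0,r)` at which the limit sine against `e_∞` is positive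
lies, from some index on, in the misaligned sets (pointwise convergence of the sines, `tendsto_dirSine`), i.e. in
`⋃_N ⋂_{j ≥ N} S_j`, a NULL set (`vol S_j ≤ ℓ_j³/(j+1) → 0`, translation invariance of Lebesgue measure); by continuity
of the limit sine the positive set is open, so it is empty: the limit vorticity slice is parallel to `e_∞` on
`B(0,r)` (`cross_eq_zero_of_dirSine_eq_zero`) and `eq_zero_of_aligned_window` forces `W_∞ ≡ 0` — contradiction.

WHAT THIS IS NOT: not NS regularity, nothing about Type II; a theorem about the (possibly trivial) class of Type-I
ancient mild profiles; `ε, δ` come from compactness and are not explicit. [folklore]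
-/

noncomputable section

-- the summit and its single sub-problem share the name (CONVENTIONS §1), as in every Theorems file
set_option linter.dupNamespace false

open Set Function Filter Topology Metric MeasureTheory
open scoped RealInnerProductSpace ENNReal
open Literature.Analysis Literature.Analysis.FluidPDE
open Summit.NavierStokesRegularity.NavierStokesRegularity.Theorems.LocalSineTubeDoorProfileAlignedWindowRigidity

namespace Summit.NavierStokesRegularity.NavierStokesRegularity.Theorems

/-- **Type-I blow-up profiles are uniformly window-decoherent in the bulk (every anchor).** For every `C`,
`κ > 0`, `λ₀ < 1`, `R₀ > 0`, `s < 0` there are `ε > 0`, `δ > 0` such that for every `W ∈ IsTypeIAncientMild C`, every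
`y₀` with `κ ≤ |curl W(s)(y₀)|` and every `e ≠ 0`:
`δ ℓ³ < vol {y : λ₀|curl W(s)(y₀)| ≤ |curl W(s)(y)|, |y₀ − y| ≤ R₀ℓ, ε < sin∠(e, ξ(y))}`, `ℓ = √(1/|curl W(s)(y₀)|)`
(module docstring for the proof). [cite: KochNadirashviliSereginSverak2009, Prop. 4.1 and Lemma 6.1 (arXiv:0709.3599 pp. 8, 11); GigaMiura2011, §2] -/
theorem typeIAncientMild_uniform_window_bulk_decoherence {C κ lam0 R0 s : ℝ} (hκ : 0 < κ) (hlam1 : lam0 < 1)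
    (hR0 : 0 < R0) (hs : s < 0) :
    ∃ ε : ℝ, 0 < ε ∧ ∃ δ : ℝ, 0 < δ ∧
      ∀ (W : ℝ → EuclideanSpace ℝ (Fin 3) → EuclideanSpace ℝ (Fin 3)), IsTypeIAncientMild C W →
      ∀ y0 : EuclideanSpace ℝ (Fin 3), κ ≤ ‖curl (W s) y0‖ → ∀ e : EuclideanSpace ℝ (Fin 3), e ≠ 0 →
        ENNReal.ofReal (δ * Real.sqrt (1 / ‖curl (W s) y0‖) ^ 3) <
          volume {y : EuclideanSpace ℝ (Fin 3) | lam0 * ‖curl (W s) y0‖ ≤ ‖curl (W s) y‖ ∧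
            ‖y0 - y‖ ≤ R0 * Real.sqrt (1 / ‖curl (W s) y0‖) ∧
            ε < Real.sqrt (1 - (inner ℝ (‖e‖⁻¹ • e) (‖curl (W s) y‖⁻¹ • curl (W s) y)) ^ 2)} := by
  by_contra hcon
  push Not at hcon
  have hseq : ∀ n : ℕ, ∃ W : ℝ → EuclideanSpace ℝ (Fin 3) → EuclideanSpace ℝ (Fin 3), IsTypeIAncientMild C W ∧
      ∃ y0 : EuclideanSpace ℝ (Fin 3), κ ≤ ‖curl (W s) y0‖ ∧ ∃ e : EuclideanSpace ℝ (Fin 3), e ≠ 0 ∧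
        volume {y : EuclideanSpace ℝ (Fin 3) | lam0 * ‖curl (W s) y0‖ ≤ ‖curl (W s) y‖ ∧
            ‖y0 - y‖ ≤ R0 * Real.sqrt (1 / ‖curl (W s) y0‖) ∧
            1 / ((n : ℝ) + 1) < Real.sqrt (1 - (inner ℝ (‖e‖⁻¹ • e) (‖curl (W s) y‖⁻¹ • curl (W s) y)) ^ 2)} ≤
          ENNReal.ofReal (1 / ((n : ℝ) + 1) * Real.sqrt (1 / ‖curl (W s) y0‖) ^ 3) :=
    fun n => hcon _ (by positivity) _ (by positivity)
  choose W hW y0 hy0 e he hvol using hseq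
  -- ## translate the window centres to the origin
  set V : ℕ → ℝ → EuclideanSpace ℝ (Fin 3) → EuclideanSpace ℝ (Fin 3) := fun n t x => W n t (x + y0 n) with hV
  have hVcl : ∀ n, IsTypeIAncientMild C (V n) := fun n =>
    translationInvariantAfter_isTypeIAncientMild_comp_add_right (hW n) (y0 n)
  have hcurlV : ∀ n y, curl (V n s) y = curl (W n s) (y + y0 n) := fun n y => by
    simp only [hV, curl, fderiv_comp_add_right]
  -- ## compactness of the class and of the sphere of unit anchors
  obtain ⟨φ, hφ, U, hU, -, hptD, -, -⟩ := exists_tendsto_of_isTypeIAncientMild_seq C hVcl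
  set f : ℕ → EuclideanSpace ℝ (Fin 3) := fun n => ‖e n‖⁻¹ • e n with hf
  have hf1 : ∀ n, ‖f n‖ = 1 := fun n => norm_smul_inv_norm (he n)
  obtain ⟨eInf, heInfmem, ψ, hψ, hfψ⟩ := (isCompact_sphere (0 : EuclideanSpace ℝ (Fin 3)) 1).tendsto_subseq
    (fun n => show f (φ n) ∈ sphere (0 : EuclideanSpace ℝ (Fin 3)) 1 from
      mem_sphere_zero_iff_norm.2 (hf1 (φ n)))
  have heInf1 : ‖eInf‖ = 1 := mem_sphere_zero_iff_norm.1 heInfmem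
  have heInf0 : eInf ≠ 0 := by
    intro h0; rw [h0, norm_zero] at heInf1; exact zero_ne_one heInf1
  set θ : ℕ → ℕ := φ ∘ ψ with hθ
  have hθt : Tendsto θ atTop atTop := hφ.tendsto_atTop.comp hψ.tendsto_atTop
  -- vorticity convergence at time `s`, pointwise, along `θ`
  have hω : ∀ y, Tendsto (fun j => curl (V (θ j) s) y) atTop (𝓝 (curl (U s) y)) := fun y => by
    have h1 : Tendsto (fun j => fderiv ℝ (V (φ (ψ j)) s) y) atTop (𝓝 (fderiv ℝ (U s) y)) :=
      (hptD s hs y).comp hψ.tendsto_atTop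
    rw [show (fun j => curl (V (θ j) s) y) = curlCLM ∘ (fun j => fderiv ℝ (V (φ (ψ j)) s) y) from rfl,
      show curl (U s) y = curlCLM (fderiv ℝ (U s) y) from rfl]
    exact (curlCLM.continuous.tendsto _).comp h1
  -- the limit amplitude at the origin
  set a : EuclideanSpace ℝ (Fin 3) := curl (U s) 0 with ha
  have hκa : κ ≤ ‖a‖ := by
    refine ge_of_tendsto (hω 0).norm (Eventually.of_forall fun j => ?_)
    rw [hcurlV, zero_add]
    exact hy0 (θ j)
  have hapos : 0 < ‖a‖ := hκ.trans_le hκa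
  have ha0 : a ≠ 0 := norm_pos_iff.1 hapos
  -- the limit profile and its vorticity slice
  have hmildU : ∀ s' t : ℝ, s' < t → t < 0 → ∀ y : EuclideanSpace ℝ (Fin 3),
      U t y = UnboundedOperators.heatExtension (U s') (t - s') y - oseenDuhamel 1 s' U U t y :=
    fun s' t hst ht y => hU.mild_eq_heatExtension hst ht y
  have hUc : Continuous (curl (U s)) :=
    continuous_curl_slice hU.hasTypeITimeDecay hU.continuousOn_uncurry hmildU hs
  -- ## a ball around the origin inside every late window
  set lam' : ℝ := max lam0 0 with hlam'
  have hlam'1 : lam' < 1 := max_lt hlam1 one_pos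
  have hlam'0 : 0 ≤ lam' := le_max_right _ _
  set m : ℝ := (1 - lam') / 2 * ‖a‖ with hm
  have hm0 : 0 < m := by have : 0 < 1 - lam' := by linarith
                         positivity
  obtain ⟨r₁, hr₁, hr₁'⟩ : ∃ r₁ > 0, ∀ y : EuclideanSpace ℝ (Fin 3), ‖y‖ < r₁ → ‖curl (U s) y - a‖ < m := by
    have hc := Metric.continuousAt_iff.1 (hUc.continuousAt (x := 0)) m hm0
    obtain ⟨δ, hδ, h⟩ := hc
    refine ⟨δ, hδ, fun y hy => ?_⟩
    have := h (by rwa [dist_zero_right])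
    rwa [dist_eq_norm] at this
  set r : ℝ := min r₁ (R0 * Real.sqrt (1 / (2 * ‖a‖))) with hr
  have hr0 : 0 < r := lt_min hr₁ (by positivity)
  have hball : ∀ y : EuclideanSpace ℝ (Fin 3), ‖y‖ < r →
      curl (U s) y ≠ 0 ∧ lam0 * ‖a‖ < ‖curl (U s) y‖ := by
    intro y hy
    have hy1 : ‖y‖ < r₁ := lt_of_lt_of_le hy (min_le_left _ _)
    have hclose := hr₁' y hy1
    have hlow : ‖a‖ - m < ‖curl (U s) y‖ := by
      have := norm_sub_norm_le a (curl (U s) y)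
      rw [norm_sub_rev] at hclose
      linarith
    have hlev : lam0 * ‖a‖ < ‖curl (U s) y‖ := by
      have h1 : lam0 * ‖a‖ ≤ lam' * ‖a‖ := mul_le_mul_of_nonneg_right (le_max_left _ _) hapos.le
      have h2 : lam' * ‖a‖ ≤ ‖a‖ - m := by rw [hm]; nlinarith
      linarith
    have hpos : 0 < ‖curl (U s) y‖ := by
      have h2 : 0 ≤ ‖a‖ - m := by rw [hm]; nlinarith
      linarith
    exact ⟨norm_pos_iff.1 hpos, hlev⟩
  have hzeroSeq : Tendsto (fun j : ℕ => 1 / ((θ j : ℝ) + 1)) atTop (𝓝 0) :=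
    tendsto_one_div_add_atTop_nhds_zero_nat.comp hθt
  -- ## the misaligned sets, moved to the origin, are asymptotically null
  set S : ℕ → Set (EuclideanSpace ℝ (Fin 3)) := fun j => (fun y => y + y0 (θ j)) ⁻¹'
    {z : EuclideanSpace ℝ (Fin 3) | lam0 * ‖curl (W (θ j) s) (y0 (θ j))‖ ≤ ‖curl (W (θ j) s) z‖ ∧
      ‖y0 (θ j) - z‖ ≤ R0 * Real.sqrt (1 / ‖curl (W (θ j) s) (y0 (θ j))‖) ∧
      1 / ((θ j : ℝ) + 1) < Real.sqrt (1 - (inner ℝ (‖e (θ j)‖⁻¹ • e (θ j))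
        (‖curl (W (θ j) s) z‖⁻¹ • curl (W (θ j) s) z)) ^ 2)} with hS
  have hvolS : ∀ j, volume (S j) ≤ ENNReal.ofReal (1 / ((θ j : ℝ) + 1) * Real.sqrt (1 / κ) ^ 3) := by
    intro j
    rw [hS, measure_preimage_add_right]
    refine (hvol (θ j)).trans (ENNReal.ofReal_le_ofReal ?_)
    have hk : Real.sqrt (1 / ‖curl (W (θ j) s) (y0 (θ j))‖) ≤ Real.sqrt (1 / κ) :=
      Real.sqrt_le_sqrt (one_div_le_one_div_of_le hκ (hy0 (θ j)))
    have hk0 : 0 ≤ Real.sqrt (1 / ‖curl (W (θ j) s) (y0 (θ j))‖) := Real.sqrt_nonneg _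
    exact mul_le_mul_of_nonneg_left (pow_le_pow_left₀ hk0 hk 3) (by positivity)
  have hbound0 : Tendsto (fun j => ENNReal.ofReal (1 / ((θ j : ℝ) + 1) * Real.sqrt (1 / κ) ^ 3)) atTop (𝓝 0) := by
    have h := (hzeroSeq.mul_const (Real.sqrt (1 / κ) ^ 3))
    rw [zero_mul] at h
    have h2 := ENNReal.tendsto_ofReal h
    rwa [ENNReal.ofReal_zero] at h2
  have hnullN : ∀ N : ℕ, volume (⋂ j ∈ Ici N, S j) = 0 := by
    intro N
    refine le_antisymm ?_ bot_le
    refine ge_of_tendsto hbound0 ?_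
    filter_upwards [eventually_ge_atTop N] with j hj
    exact (measure_mono (biInter_subset_of_mem (show j ∈ Ici N from hj))).trans (hvolS j)
  have hLnull : volume (⋃ N : ℕ, ⋂ j ∈ Ici N, S j) = 0 := measure_iUnion_null hnullN
  -- ## every point of the ball with positive limit sine is eventually in the misaligned sets
  have hmemL : ∀ y : EuclideanSpace ℝ (Fin 3), ‖y‖ < r →
      0 < Real.sqrt (1 - (inner ℝ (‖eInf‖⁻¹ • eInf) (‖curl (U s) y‖⁻¹ • curl (U s) y)) ^ 2) →
      y ∈ ⋃ N : ℕ, ⋂ j ∈ Ici N, S j := by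
    intro y hy hpos
    obtain ⟨hb0, hlev⟩ := hball y hy
    have hlim : Tendsto (fun j => Real.sqrt (1 - (inner ℝ (‖f (θ j)‖⁻¹ • f (θ j))
        (‖curl (V (θ j) s) y‖⁻¹ • curl (V (θ j) s) y)) ^ 2)) atTop
        (𝓝 (Real.sqrt (1 - (inner ℝ (‖eInf‖⁻¹ • eInf) (‖curl (U s) y‖⁻¹ • curl (U s) y)) ^ 2))) :=
      tendsto_dirSine heInf0 hb0 hfψ (hω y)
    have hn0 : Tendsto (fun j => ‖curl (V (θ j) s) 0‖) atTop (𝓝 ‖a‖) := (hω 0).norm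
    have hny : Tendsto (fun j => ‖curl (V (θ j) s) y‖) atTop (𝓝 ‖curl (U s) y‖) := (hω y).norm
    have e1 : ∀ᶠ j in atTop, ‖curl (V (θ j) s) 0‖ < 2 * ‖a‖ := hn0.eventually_lt_const (by linarith)
    have e2 : ∀ᶠ j in atTop, 0 < ‖curl (V (θ j) s) y‖ - lam0 * ‖curl (V (θ j) s) 0‖ :=
      (hny.sub (hn0.const_mul lam0)).eventually_const_lt (by linarith)
    have e3 : ∀ᶠ j in atTop, ‖a‖ / 2 < ‖curl (V (θ j) s) 0‖ := hn0.eventually_const_lt (by linarith)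
    have e4 : ∀ᶠ j in atTop, Real.sqrt (1 - (inner ℝ (‖eInf‖⁻¹ • eInf) (‖curl (U s) y‖⁻¹ • curl (U s) y)) ^ 2) / 2 <
        Real.sqrt (1 - (inner ℝ (‖f (θ j)‖⁻¹ • f (θ j)) (‖curl (V (θ j) s) y‖⁻¹ • curl (V (θ j) s) y)) ^ 2) :=
      hlim.eventually_const_lt (by linarith)
    have e5 : ∀ᶠ j in atTop, 1 / ((θ j : ℝ) + 1) <
        Real.sqrt (1 - (inner ℝ (‖eInf‖⁻¹ • eInf) (‖curl (U s) y‖⁻¹ • curl (U s) y)) ^ 2) / 2 :=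
      hzeroSeq.eventually_lt_const (by linarith)
    have hev : ∀ᶠ j in atTop, y ∈ S j := by
      filter_upwards [e1, e2, e3, e4, e5] with j h1 h2 h3 h4 h5
      have hunit : ‖f (θ j)‖⁻¹ • f (θ j) = ‖e (θ j)‖⁻¹ • e (θ j) := by
        rw [hf1, inv_one, one_smul]
      have hcen : 0 < ‖curl (V (θ j) s) 0‖ := by linarith
      refine ⟨?_, ?_, ?_⟩
      · -- relative level
        have := h2
        rw [hcurlV, hcurlV, zero_add] at this
        linarith
      · -- inside the window
        have e0 : y0 (θ j) - (y + y0 (θ j)) = -y := by abel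
        rw [e0, norm_neg]
        have hc0 : ‖curl (W (θ j) s) (y0 (θ j))‖ = ‖curl (V (θ j) s) 0‖ := by rw [hcurlV, zero_add]
        rw [hc0]
        have hy2 : ‖y‖ < R0 * Real.sqrt (1 / (2 * ‖a‖)) := lt_of_lt_of_le hy (min_le_right _ _)
        have hmono : Real.sqrt (1 / (2 * ‖a‖)) ≤ Real.sqrt (1 / ‖curl (V (θ j) s) 0‖) :=
          Real.sqrt_le_sqrt (one_div_le_one_div_of_le hcen h1.le)
        nlinarith [mul_le_mul_of_nonneg_left hmono hR0.le]
      · -- misaligned beyond `1/(θ j + 1)`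
        have h45 := h5.trans h4
        rw [hunit, hcurlV] at h45
        exact h45
    obtain ⟨N, hN⟩ := eventually_atTop.1 hev
    exact mem_iUnion.2 ⟨N, mem_iInter₂.2 fun j hj => hN j hj⟩
  -- ## hence the limit sine vanishes on the ball (its positivity set is open and null)
  have hal' : ∀ y ∈ ball (0 : EuclideanSpace ℝ (Fin 3)) r, cross (curl (U s) y) eInf = 0 := by
    intro y₁ hy₁
    rw [mem_ball, dist_zero_right] at hy₁
    obtain ⟨hb0, -⟩ := hball y₁ hy₁
    refine cross_eq_zero_of_dirSine_eq_zero heInf0 hb0 ?_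
    by_contra hne
    have hpos : 0 < Real.sqrt (1 - (inner ℝ (‖eInf‖⁻¹ • eInf) (‖curl (U s) y₁‖⁻¹ • curl (U s) y₁)) ^ 2) :=
      lt_of_le_of_ne (dirSine_nonneg _ _) (Ne.symm hne)
    -- continuity of the limit sine at `y₁`
    have hca : Tendsto (fun y => Real.sqrt (1 - (inner ℝ (‖eInf‖⁻¹ • eInf)
        (‖curl (U s) y‖⁻¹ • curl (U s) y)) ^ 2)) (𝓝 y₁)
        (𝓝 (Real.sqrt (1 - (inner ℝ (‖eInf‖⁻¹ • eInf) (‖curl (U s) y₁‖⁻¹ • curl (U s) y₁)) ^ 2))) :=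
      tendsto_dirSine (f := fun _ => eInf) heInf0 hb0 tendsto_const_nhds (hUc.tendsto y₁)
    have hev : ∀ᶠ y in 𝓝 y₁, 0 < Real.sqrt (1 - (inner ℝ (‖eInf‖⁻¹ • eInf)
        (‖curl (U s) y‖⁻¹ • curl (U s) y)) ^ 2) ∧ ‖y‖ < r := by
      refine (hca.eventually_const_lt hpos).and ?_
      have : ∀ᶠ y in 𝓝 y₁, y ∈ ball (0 : EuclideanSpace ℝ (Fin 3)) r :=
        isOpen_ball.eventually_mem (by rwa [mem_ball, dist_zero_right])
      exact this.mono fun y hy => by rwa [mem_ball, dist_zero_right] at hy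
    obtain ⟨ρ, hρ, hρsub⟩ := Metric.eventually_nhds_iff_ball.1 hev
    have hsub : ball y₁ ρ ⊆ ⋃ N : ℕ, ⋂ j ∈ Ici N, S j := fun y hy =>
      hmemL y (hρsub y hy).2 (hρsub y hy).1
    have hballpos : 0 < volume (ball y₁ ρ) := measure_ball_pos volume y₁ hρ
    have hballnull : volume (ball y₁ ρ) = 0 := measure_mono_null hsub hLnull
    exact hballpos.ne' hballnull
  -- ## the aligned-window rigidity forces the limit profile to vanish
  have hUzero : ∀ t < 0, ∀ y, U t y = 0 :=
    eq_zero_of_aligned_window hU.hasTypeITimeDecay hU.continuousOn_uncurry hmildU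
      (fun t ht => hU.isDivFree ht) hs heInf0 isOpen_ball ⟨0, mem_ball_self hr0⟩ hal'
  have hUs : U s = fun _ => (0 : EuclideanSpace ℝ (Fin 3)) := funext fun y => hUzero s hs y
  have ha' : a = 0 := by
    rw [ha]
    apply curl_eq_zero_of_fderiv_eq_zero
    rw [hUs]
    simp
  exact ha0 ha'

/-- **Type-I blow-up profiles are uniformly window-decoherent in the bulk (anchor at the centre)** — the uniform
negation, over the class `IsTypeIAncientMild C`, of the window clause of the measure-form doors W3ʷᵇ/W3ᵐᵗ read at a
profile: for every `C`, `κ > 0`, `λ₀ < 1`, `R₀ > 0`, `s < 0` there are `ε > 0`, `δ > 0` with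
`δℓ³ < vol {y : λ₀|curl W(s)(y₀)| ≤ |curl W(s)(y)|, |y₀ − y| ≤ R₀ℓ, ε < sin∠(ξ(y₀), ξ(y))}`,
`ℓ = √(1/|curl W(s)(y₀)|)`, for every profile `W` and every `y₀` with `κ ≤ |curl W(s)(y₀)|`. [folklore] -/
theorem typeIAncientMild_uniform_window_bulk_decoherence_anchored {C κ lam0 R0 s : ℝ} (hκ : 0 < κ)
    (hlam1 : lam0 < 1) (hR0 : 0 < R0) (hs : s < 0) :
    ∃ ε : ℝ, 0 < ε ∧ ∃ δ : ℝ, 0 < δ ∧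
      ∀ (W : ℝ → EuclideanSpace ℝ (Fin 3) → EuclideanSpace ℝ (Fin 3)), IsTypeIAncientMild C W →
      ∀ y0 : EuclideanSpace ℝ (Fin 3), κ ≤ ‖curl (W s) y0‖ →
        ENNReal.ofReal (δ * Real.sqrt (1 / ‖curl (W s) y0‖) ^ 3) <
          volume {y : EuclideanSpace ℝ (Fin 3) | lam0 * ‖curl (W s) y0‖ ≤ ‖curl (W s) y‖ ∧
            ‖y0 - y‖ ≤ R0 * Real.sqrt (1 / ‖curl (W s) y0‖) ∧
            ε < Real.sqrt (1 - (inner ℝ (‖curl (W s) y0‖⁻¹ • curl (W s) y0)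
              (‖curl (W s) y‖⁻¹ • curl (W s) y)) ^ 2)} := by
  obtain ⟨ε, hε, δ, hδ, h⟩ := typeIAncientMild_uniform_window_bulk_decoherence (C := C) hκ hlam1 hR0 hs
  refine ⟨ε, hε, δ, hδ, fun W hW y0 hy0 => h W hW y0 hy0 (curl (W s) y0) ?_⟩
  have : 0 < ‖curl (W s) y0‖ := hκ.trans_le hy0
  exact norm_pos_iff.1 this

end Summit.NavierStokesRegularity.NavierStokesRegularity.Theorems

end
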